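import Mathlib
import HarnessLib
import HarnessLib.Audit
import Summits.QuantumAdvantage.Statement
import Literature.Computability.Cryptography.ClassBQP
import Literature.Computability.Complexity.Randomized
import Literature.Computability.Complexity.BoolEncodings
import HarnessLib.Audit.Status.Attr

/-!
Route: PadKuperberg

DORMANT since 2026-08-22T20:48:57Z (reconciler: no traction for 5.6 d (last activity item-evidence-added at 2026-08-17T04:36:42Z); parked, not closed — `ledger route dormant route-QuantumAdvantage-PadKuperberg --off` to reactivate) — unstaffed, not closed; items shared with open routes are served there. `ledger route dormant <id> --off` reactivates.

Route PadKuperberg (realises idea card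
QuantumAdvantage/QuantumAdvantage/pad-kuperberg-torsor-bridge).
THESIS X (= item TorsorHard, words): there is a WHITE-BOX TORSOR FAMILY -- for each parameter string
prm a finite abelian group of canonical labels (validity `lab`, law `mul`, unit `one`, generating
list `gens`, all polynomial-time) acting FREELY AND TRANSITIVELY (`act`) on a polynomial-time
decidable set of elements (`elt`), the action by an arbitrary label being computable in time
polynomial in the SUBEXPONENTIAL padding m_d(l) = 2^(d*isqrt(l*log2 l)+d), l = |prm| -- whose
VECTORIZATION problem (given valid z0, z1 output the unique label g with g*z0 = z1) has, for every
c', NO randomized classical algorithm running in time 2^(c'*isqrt(l*log2 l)+c') * (|input|+1)^c'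
with success >= 2/3 on all valid instances. (Post-quantum hardness at subexponential scale;
instantiated by the CM torsor Cl(Z[sqrt(-p)]) acting on supersingular curves over F_p -- CRS/CSIDH
vectorization, classical record p^(1/4).)
Lean (one line, over existing decls only; elaborates rc 0):
`Summit.QuantumAdvantage.QuantumAdvantage.Theses.PadKuperberg.TorsorHard` :=
  ∃ d lab elt one mul act gens, (torsor axioms) ∧ (PolyTimeComputable clauses; act poly-time on the
m_d-padded encoding) ∧ ∀ c', ¬ ∃ A : Literature.Computability.Complexity.RandAlg (List Bool × List
Bool × List Bool) (List Bool), A.RunsInTime enc id (fun t => 2 ^ (c' * Nat.sqrt (l * Nat.log 2 l) +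
c') * (|enc t| + 1) ^ c') ∧ ∀ valid (prm,z0,z1), 2/3 ≤ A.pr enc (prm,z0,z1) {g | lab prm g ∧ act prm
g z0 = z1}.
IT SUFFICES: X → QuantumAdvantage via the two frame statements
 #0 KuperbergPad (support since the retriage of 2026-08-15 -- known in print, Herculean to
formalise; theorem-target): for every such family the PADDED vectorization-bit language L_pad = {
<<prm,z0,z1,1^i>, 1^(m_c l)> : bit i of boolPair g [] = 1 for the unique g } is in
Literature.Computability.Cryptography.BQP (Kuperberg's abelian hidden-shift sieve, quant-ph/0302112
Thm 7.1, time 2^O(sqrt log|G|) <= poly(m_c), after Cheung-Mosca structure computation from gens;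
hidden shift f1(g) = f0(g+s) with f_b(g) = act g z_b, injective by freeness);
 #1 PadDown (support, provable now): L_pad ∈ Literature.Computability.Complexity.BPP → a randomized
classical vectorization algorithm in time 2^(c'*isqrt(l log l)+c')·poly (query the 2l+2 bits, Gill
form of BPP + amplification + self-delimiting decoding);
 Assembly := KuperbergPad → PadDown → TorsorHard → QuantumAdvantage (pure logic: the witness L is
L_pad(c) for the c of KuperbergPad at the family's d; checked rc 0 in the planner's sketch with an
explicit proof term).
The summit never asked the quantum algorithm to be polynomial: only that the RATIO of exponents log
T_classical / log T_quantum diverge (ratio lemma R0 of the card = #1 + the definitional half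
absorbed into L_pad ∈ BQP).

Rationale: WHY THIS LINE. Every language-level bridge on the hub (Shor, DLOG/AvgCase, CircuitLB-at-FACT)
borrows hardness that a quantum computer BREAKS in polynomial time. This route borrows POST-QUANTUM
hardness instead: strip an abelian group of its law and keep a free transitive action (hard
homogeneous space, Couveignes 2006; cryptographic group action, eprint 2020/1188). Classically
vectorization drops to exponential (generic-action birthday bound |G|^(1/2), Montgomery-Zhandry
ASIACRYPT 2022; isogeny record p^(1/4), Delfs-Galbraith arXiv:1310.7789), quantumly only to
SUBEXPONENTIAL (Kuperberg quant-ph/0302112 Thm 7.1, Regev quant-ph/0406151, Childs-Jao-Soukharev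
arXiv:1012.4019 under GRH) -- and input padding (Book 1974; Hartmanis-Immerman-Sewelson 1985)
converts a divergent exponent ratio into a BQP language outside BPP. Uniqueness of the vectorization
(freeness) replaces the promise->language lift PL that PromiseLift needs; no open quantum crux of
consensus-false type (contrast lattice/eDCP). Imported areas: hidden-shift quantum algorithms, CM
theory / isogeny graphs (instantiation), structural padding arguments.
RANKED CRUXES.
 TENURE DECISION (route-repair 2026-08-15, after retriage 2->1; the route reviews gen-0, g2, gen-1,
gen-2 all concur): this route is a CONDITIONAL BRIDGE on its item TorsorHard (= thesis X,
hypothesis-type: a super-polynomial classical lower bound for an explicit search problem, the kind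
of statement no known technique proves --
Literature.Barriers.QuantumAdvantage.SeparationPrerequisites applies to X, and refuters rightly do
not stamp it for provers). The deciding theorem `closes : KuperbergPad -> PadDown -> TorsorHard ->
QuantumAdvantage` is proved in this file (rev 2); the earned content of the line is KuperbergPad +
PadDown. The ledger flag conditional_bridge/conditional_on can only be set at route-open (operator:
conditional_on := TorsorHard). Every other step of a hardness bridge is known in print, so no second
CONJECTURE is filed; the second crux, TorsorWitness (rank 4), is the line's cheapest falsifier made
into a served item -- the non-vacuity of the shared typed interface at full size, unverified as
typed and decidable either way now -- not a restatement of X.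
 rank 3 TorsorHard [crux, hypothesis-type = X; the bridge's named conjecture]: why it might fail: a
classical 2^O(sqrt(l log l)) vectorization for CRS/CSIDH (transport of class-group index calculus to
the curve side; none since Couveignes 1997; Castryck-Decru 2022 broke torsion-point SIDH, not
commutative actions) -- or no instantiation satisfies the interface as typed (ONE deterministic
padded-poly `act` on all canonical labels and a P-time generating list: for CSIDH both are in print
only randomized and under GRH -- Bach generators, L(1/2) smoothing arXiv:1012.4019, Clapotis eprint
2023/1766). GRH-free intended witness (refuter review gen-0, evidence on the TorsorHard item): the
EC-DLOG torsor, (Z/n,+) acting by a * Z = Z + a.P on <P> = E(F_q)[n] for prime q, short Weierstrass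
E/F_q, prime n with n^2 > 2q+1 (so the n-torsion of E(F_q), of order <= 2q+1 < n^2, is exactly <P>),
validity decided certificate-free in P (AKS for q and n; on-curve and n.P = O checks) so that |prm|
= Theta(log|G|) -- with Theta(log^2)-bit certificates in prm the hardness clause dies by exhaustive
search (gen-2 precision point; the same rule binds CsidhInstantiation's eventual signature: |prm| <=
C log2|G|). At that witness X <= worst-case subexponential hardness of prime-field ECDLP and the
route meets Shor's crux 4 + padding; post-quantumness is then decorative, assumption diversity is
the value. Sources: eprint 2018/383 s7, arXiv:1310.7789, arXiv:1012.4019, eprint 2018/537, 2019/725,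
Galbraith-Gaudry 2016 (DCC 78) for ECDLP records.
 rank 4 TorsorWitness [crux, sanity/non-vacuity, decidable now] (NEW, typed: the interface clauses
shared verbatim by TorsorHard/KuperbergPad/PadDown -- 13 torsor axioms + 6 TM2-level
PolyTimeComputable clauses incl. the m_d-padded `act` encoding and the listBool-encoded `gens` --
are met by a FULL-SIZE family, every length-|prm| string a label, e.g. (Z/2)^l acting on itself by
xor with unit-vector generators and d = 0; this is the non-vacuity pass the retriage asked for, and
it de-risks X: were only families with |G_prm| = 2^o(sqrt(l log l)) admissible, Cayley-graph
enumeration from `gens` plus `act`-tests would vectorize within the forbidden budget and X would be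
false by typing). Why it might fail: the six TM2-level PolyTimeComputable clauses (padded `act`
encoding, listBool `gens`), clause 13 and clause 11 have never been met together by a nontrivial
family.
 rank 2 KuperbergPad [support since retriage 2026-08-15 -- known in print, Herculean to formalise;
theorem-target]: Kuperberg+Cheung-Mosca over an abstract white-box torsor family, padded, inside the
tree's uniform Clifford+T BQP; c := max(d,1) suffices (BQP's polynomial absorbs the family's
degrees; verify-then-amplify handles every string incl. malformed paddings). Vocabulary risk only:
the adaptive sieve (mid-circuit measurements, random pairing, space 2^O(sqrt l)) compiled coherently
into ONE uniform oracle-free family; group structure from generators via Cheung-Mosca (orders via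
Shor, relations via HSP on Z^k). Reusable tree infrastructure: P_subset_BQP_holds,
FACT_mem_BQP_holds, isQSolvable_dlog_holds, QFTZModPow (Literature.Computability.QuantumComplexity).
Sources: quant-ph/0302112 Thm 7.1, quant-ph/0406151, Cheung-Mosca 2001 (arXiv:cs/0101004),
arXiv:1012.4019 Thm 12-13, doi:10.1515/jmc-2015-0057.
 support PadDown (provable modulo the tree's TM2 closure lemmas: PolyTimeComputable.comp_holds,
boolPair/unpair machines, amplification). support CsidhInstantiation (informal until
defn-csidhTorsorFamily lands; route-repair g3 2026-08-15): the mathematical CSIDH data LANDED in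
Literature (defn-csidhAction DONE:
Literature.Computability.Cryptography.Csidh.curve/IsCoeff/act/gens, the named fact
Csidh.csidh_classGroupAction = CSIDH Thm 7 + Prop 8, Csidh.jmv_smallPrimesGenerate (ERH) with
exists_closure_toClass_gens_eq_top, and Quadratic.BinQF.IsLabel/comp/principalForm with
cox_formClassGroup_holds PROVED); what is still missing is the BIT-LEVEL family (encodings of p /
reduced forms / Montgomery coefficients, padded prm with |prm| = Theta(log p), junk prm -> trivial
one-point torsor), filed g3 as definition item defn-csidhTorsorFamily
(Literature/Computability/Cryptography). Its signature afterwards: (clauses (1)-(3) of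
csidh_classGroupAction written INLINE for p) -> (exists P0, generation of cl(Z[sqrt -p]) by
Csidh.gens p for p >= P0, inline) -> (the six PolyTimeComputable clauses for that family at some
exponent d; the deterministic padded-poly `act` on ALL labels is an explicit hypothesis, in print
only randomized L_p(1/2) under GRH / Clapotis) -> (hardness conjunct of TorsorHard for that family =
H_iso(CSIDH)) -> TorsorHard; provable content = the 13 axioms via cox_formClassGroup_holds, label
length <= |prm|, generation normal form, junk handling. DESIGN RULE (staffability): the named facts
csidh_classGroupAction / jmv_smallPrimesGenerate / ExtendedRiemannHypothesis are never named in an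
item (cite_only facts and undeclared-conjecture leaves in the constant cone unstaff the route, cf.
`ledger route staffable`); their content enters as inline hypotheses. support GenericActionLB (TYPED
g3 over the tree's OracleAlg, no new definition, no named fact: Z/(n+1) in the clear acting by
translation on points carrying uniformly random labels sigma : Perm (ZMod (n+1)), the only access an
action oracle <a,y> |-> label of sigma^-1(y)+a (boolPair/encodeNat plumbing); for every
deterministic q-round OracleAlg the number of (sigma, g) on which it outputs g from the labels of 0
and g is <= C (q+1)^2/(n+1) of all (n+1)!(n+1) pairs -- the birthday/lazy-sampling bound a la Shoup
1997, Montgomery-Zhandry 2022, Duman et al. eprint 2023/186; restricted-model evidence for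
TorsorHard and the classical half of the relativized separation; provable now (combinatorics), not a
hypothesis of `closes`). CONE (g3): 60 project constants, 0 unproved; needs-fact: NONE; imports
ClassBQP/Randomized/BoolEncodings all load-bearing; the crux-floor stamp of 14:53Z predates rev 4
(TorsorWitness) and is stale.
KILL CRITERIA. (a) classical subexponential CSIDH/CRS vectorization in 2^O(sqrt(n log n)) kills the
post-quantum instantiation only (the EC-DLOG witness survives; the route dies only if EVERY nameable
torsor family falls, i.e. with worst-case subexp ECDLP as well); (b) a refuter shows the interface
unsatisfiable by any P-uniform family at size (refutes TorsorWitness) -> re-type the shared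
interface clauses (restate TorsorHard/KuperbergPad/PadDown together), never a kill of the line; (b')
CSIDH cannot meet the interface without GRH/derandomisation -> CsidhInstantiation keeps
generation-under-GRH and deterministic padded-poly action evaluation as explicit inline antecedents
(planned signature above); (b'') GenericActionLB refuted (an algorithm beating the birthday bound in
the generic action model) would only remove restricted-model evidence, never break `closes`; (c)
KuperbergPad false as typed for model reasons -> restate (never a kill of the line).
NOT DECOMPOSED YET. Cheung-Mosca as its own item; QFT over Z_N inside Clifford+T (exists for Shor:
QFTZModPow); coherent sieve bookkeeping; the CSIDH BIT-LEVEL family (definition item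
defn-csidhTorsorFamily, filed g3; the mathematical definitions
CsidhAction/CsidhGenerators/ZsqrtdFormClassGroup have landed, Velu formulas / Schoof P-time counting
/ Clapotis evaluation stay cite-level hypotheses); a TYPED EC-DLOG instantiation `EcdlpSubexpHard ->
TorsorHard` over Mathlib's WeierstrassCurve.Affine.Point (ZMod q) group law (deferred: it is known
in print, adds no crux, and its conjecture half duplicates Shor crux 4); Regev's poly-space variant;
nonuniform/AvgCase feeds (JMV expander rerandomisation) -- all deliberately below the two-layer
floor until KuperbergPad is grounded.
CHEAPEST FALSIFIER. Try to refute TorsorWitness: exhibit that no full-size family can meet clause 13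
(generation in the foldr/zipWith/iterate form), clause 11 (|g| <= |prm|) and the six
PolyTimeComputable clauses simultaneously -- one afternoon against the xor family; a refutation
exposes a typing defect shared by all three load-bearing items before any prover time is spent.
Second cheapest: a literature check for a classical L_p(1/2)-or-better CRS/CSIDH vectorization
(kills only the post-quantum witness). GenericActionLB: try small cases (n+1 <= 8, q <= 3) by
exhaustive enumeration of OracleAlg step tables against all (sigma, g) -- any success ratio above
C(q+1)^2/(n+1) for growing n would expose a typing slip in the oracle plumbing (labels read mod n+1,
malformed queries decode to (0,0)).
SOURCES: Kuperberg2005 (doi:10.1137/s0097539703436345), Regev quant-ph/0406151, ChildsJaoSoukharev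
arXiv:1012.4019, CheungMosca2001 arXiv:cs/0101004, JaoLeGrowLeonardiRuizLopez2020
doi:10.1515/jmc-2015-0057, CSIDH eprint 2018/383, BonnetainSchrottenloher eprint 2018/537, Peikert
eprint 2019/725, DelfsGalbraith arXiv:1310.7789, MontgomeryZhandry ASIACRYPT 2022, PageRobert
Clapotis eprint 2023/1766, Couveignes eprint 2006/291, AlamatiDeFeoMontgomeryPatranabis eprint
2020/1188, GalbraithGaudry2016 (Des. Codes Cryptogr. 78), Book 1974, HartmanisImmermanSewelson 1985.

Novelty: NOVELTY (searched 2026-08-15: card audit refuter-novelty-audit-11 READ arXiv:1112.3333 p3,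
arXiv:1012.4019, quant-ph/0302112, cs/0304005 p7 + sibling-card grep; this planner: `lit read
arxiv:quant-ph/0302112` Thm 1.1 p3 / Thm 7.1 p11 (abelian hidden shift 2^O(sqrt n) uniformly for all
f.g. abelian groups), `lit galaxy search "generic group action model" --star all` (->
Montgomery-Zhandry ASIACRYPT 2022 pdf; Zhandry quantum money from group actions arXiv:2307.12120),
`lit frontier QuantumAdvantage --since 2022` (30 rows, none on group actions/padding), arXiv/zbMATH
remote 429/0 hits for "Kuperberg CSIDH complexity class separation padding").
Nearest prior art: (1) Kuperberg 2011 arXiv:1112.3333 p3 prints the analogy 'isogenies : hidden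
shift :: factoring : Shor' and CJS arXiv:1012.4019 give the L(1/2) quantum isogeny algorithm under
GRH; (2) CSIDH eprint 2018/383 Thm 7 (free transitive action) + Delfs-Galbraith arXiv:1310.7789
(classical p^(1/4)); (3) generic group-action model lower bounds: Montgomery-Zhandry 2022, Duman et
al. eprint 2023/186; (4) padding/upward translation: Book 1974, Hartmanis-Immerman-Sewelson 1985
(and in-hub: dequantization-exponent-ladder's rung rule). NOT found in print or on the hub: a
conditional proof of BQP != BPP from a POST-QUANTUM assumption with theorem-grade quantum half and
no promise lift, i.e. the padded statement (H_iso => exists L in BQP \ BPP via Kuperberg); nor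
Kuperberg's theorem stated over an abstract white-box torsor interface insi  [refs: 1112.3333, 1012.4019, quant-ph/0302112, 2307.12120, 1310.7789, arxiv:quant-ph/0302112]

Barriers (technique_class: conditional-bridge, padding, hidden-shift): Literature.Barriers.QuantumAdvantage.SeparationPrerequisites: APPLIES to the conclusion (TorsorHard
-> summit -> PP ⊄ BPP, P != PSPACE); NOT evaded -- TorsorHard is hypothesis-type (a classical
fine-grained lower bound nobody can prove); the route's earned content is KuperbergPad + PadDown.
Literature.Barriers.QuantumAdvantage.Relativization: the padded separation RELATIVIZES in the
generic-action model (oracle separation: Kuperberg 2^O(sqrt log N) queries vs Omega(sqrt N)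
classical), so as for Shor the unrelativized content is exactly the white-box instantiation + H_iso;
consistent, not evaded; KuperbergPad itself is an inclusion that relativizes harmlessly.
Literature.Barriers.QuantumAdvantage.Algebrization: same status as Relativization (no
arithmetization anywhere; an algebrizing proof of TorsorHard composed with KuperbergPad would
algebrize BQP ⊄ BPP, excluded by Algebrization.not_isAlgebrizingSeparation_bqp_bpp) -- not evaded, X
is a hypothesis.
Literature.Barriers.QuantumAdvantage.TotalFunctionSpeedupLimit: NOT engaged -- vectorization has
total inputs but the oracle (a group ACTION) is structured; Beals et al. D <= 4096 Q^6 concerns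
unstructured total Boolean functions.
Literature.Barriers.QuantumAdvantage.PPolyOracles: an action given by circuits is an
efficiently-computable-oracle separation, which by Aaronson-Chen Thm 7.6/8.1 needs an unrelativized
assumption -- H_iso is that assumption; consistent.
Literature.Barriers.QuantumAdvantage.RandomOracleMethod: instances

Novelty grade: new-combination — ROUTE REVIEW gen-2 = 3rd independent recheck (refuter rreview-1c01669c-g2; gen-0/g2/gen-1 stand). KEEP OPEN; new-combination (concur, modest: Kuperberg/CJS hidden shift ⊕ Book padding ⇒ conditional BQP⊄BPP from subexp hardness, theorem-grade quantum half, no promise lift). Not a recombination of CLO (refuter refuter-rreview-route-CriticalPhenomena--1c01669c-g2-0, 2026-08-15T14:51:46Z; prior: arXiv:quant-ph/0302112 Kuperberg 2005 Thm 7.1 (abelian hidden shift 2^{O(√n)}), arXiv:1012.4019 Childs–Jao–Soukharev §4–5 (free CM action ⇒ hidden shift, L(1/2) under GRH), arXiv:cs/0101004 Cheung–Mosca 2001 (black-box abelian group structure), eprint 2018/383 CSIDH Thm 7; arXiv:1310.7789 Delfs–Galbraith (p^{1/4}), Montgomery–Zhandry ASIACRYPT 2022 / eprint 2023/186 (generic-action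 Ω(√N)), Book 19)

History (route lifecycle, newest last):
- 2026-08-22T20:48:57Z · DORMANT — reconciler: no traction for 5.6 d (last activity item-evidence-added at 2026-08-17T04:36:42Z); parked, not closed — `ledger route dormant route-QuantumAdvantage (operator:999:3594694)

sub-problem: QuantumAdvantage · status: dormant · opened planner-plancards-QuantumAdvantage-QuantumAdvantage-20260815w1-1-0 2026-08-15T10:36:24Z · rev 6 · ledger route-QuantumAdvantage-PadKuperberg
GENERATED by the gate from the ledger (D-0016/17). Provers cite these decls: `theorem foo : Summit.QuantumAdvantage.QuantumAdvantage.Theses.PadKuperberg.<Decl> := …` in Summits/QuantumAdvantage/QuantumAdvantage/Theorems/<Name>.lean.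
-/

namespace Summit.QuantumAdvantage.QuantumAdvantage.Theses.PadKuperberg

open scoped BigOperators Topology Manifold Classical MeasureTheory ProbabilityTheory Matrix InnerProductSpace ComplexConjugate ContinuousMap
open Filter Set Function TopologicalSpace MeasureTheory

attribute [summit_statement] _root_.QuantumAdvantage

open Literature.QuantumAdvantage

/-- item stmt-QuantumAdvantage-0927 · crux · rank 3 · open · by planner
why it might fail: X itself (hypothesis-type; X => NP not in BPP). False if every P-uniform torsor family has a classical 2^O(sqrt(l log l)) vectorization (CSIDH record 2^(l/4); generic Omega(sqrt N)). As typed, act = ONE deterministic padded-poly TM on all labels, gens must generate: in print only randomized + GRH.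
sources: eprint 2018/383 s7 + Thm 7 (CSIDH: free transitive action of Cl(Z[sqrt -p]) on F_p-supersingular Montgomery curves on the floor; classical/quantum security estimates), arXiv:1310.7789 (Delfs-Galbraith: isogenies between supersingular curves over F_p, classical O~(p^(1/4))), arXiv:1012.4019 s4-5 (Childs-Jao-Soukharev: action of an ARBITRARY ideal class via L(1/2) lattice smoothing, randomized, under GRH; generators up to the Bach bound 6 log^2|D| need GRH), eprint 2023/1766 (Page-Robert, Clapotis: class group action evaluation for arbitrary ideals in polynomial time via higher-dimensional isogenies; cited from PQCrypto 2024 LNCS 14771 ref. 43), Montgomery-Zhandry ASIACRYPT 2022 (LNCS 13791) + eprint 2023/186 (generic group action model: classical vectorization needs Omega(sqrt N) queries), eprint 2006/291 (Couveignes, hard homogeneous spaces); eprint 2020/1188 (Alamati-De Feo-Montgomery-Patranabis: (restricted) effective group actions)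
[crux] THESIS X, hypothesis-type (refuters: do not staff provers). There EXISTS a white-box torsor
family as in KuperbergPad (same interface clauses, some action-time exponent d) whose vectorization
(given valid prm, z0, z1 output the unique label g with act prm g z0 = z1) admits, for every c', NO
randomized classical algorithm A : RandAlg with RunsInTime <= 2^(c'*isqrt(l*log2 l)+c') *
(|enc(prm,z0,z1)|+1)^c' and success probability >= 2/3 on every valid instance. Intended witness
(support item CsidhInstantiation): the ideal class group of Z[sqrt(-p)] (p = 3 mod 4 prime), labels
= reduced binary quadratic forms, gens = small split prime forms (generation under GRH/Bach), acting
by isogenies on supersingular Montgomery curves over F_p with F_p-endomorphism ring Z[sqrt(-p)]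
(free and transitive: Waterhouse 1969 / Schoof 1987 / CSIDH eprint 2018/383 Thm 7; arbitrary classes
act in time L_p(1/2) after lattice smoothing, Childs-Jao-Soukharev arXiv:1012.4019, GRH), classical
record p^(1/4) = 2^(l/4) (Delfs-Galbraith arXiv:1310.7789; meet-in-the-middle), generic-action lower
bound Omega(|G|^(1/2)) (Montgomery-Zhandry ASIACRYPT 2022). A post-quantum assumption at
SUBEXPONENTIAL scale: weak -/
@[route_item "route-QuantumAdvantage-PadKuperberg", crux]
def TorsorHard : Prop :=
  ∃ (d : ℕ) (lab elt : List Bool → List Bool → Bool) (one : List Bool → List Bool) (mul act : List Bool → List Bool → List Bool → List Bool) (gens : List Bool → List (List Bool)), ((∀ p g h, lab p g = true → lab p h = true → lab p (mul p g h) = true) ∧ (∀ p, lab p (one p) = true) ∧ (∀ p g, lab p g = true → mul p (one p) g = g) ∧ (∀ p g h k, lab p g = true → lab p h = true → lab p k = true → mul p (mul p g h) k = mul p g (mul p h k)) ∧ (∀ p g h, lab p g = true → lab p h = true → mul p g h = mul p h g) ∧ (∀ p g, lab p g = true → ∃ h, lab p h = true ∧ mul p g h = one p) ∧ (∀ p g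 z, lab p g = true → elt p z = true → elt p (act p g z) = true) ∧ (∀ p z, elt p z = true → act p (one p) z = z) ∧ (∀ p g h z, lab p g = true → lab p h = true → elt p z = true → act p (mul p g h) z = act p g (act p h z)) ∧ (∀ p z₀ z₁, elt p z₀ = true → elt p z₁ = true → ∃! g, lab p g = true ∧ act p g z₀ = z₁) ∧ (∀ p g, lab p g = true → g.length ≤ p.length) ∧ (∀ p, ∀ h ∈ gens p, lab p h = true) ∧ (∀ p g, lab p g = true → ∃ es : List ℕ, g = (List.zipWith (fun h e => (mul p h)^[e] (one p)) (gens p) es).foldr (mul p) (one p))) ∧ (Literature.Computability.Complexity.PolyTimeComputable (fun q : List Bool × List Bool => Literature.Computability.Complexity.boolPair q.1 q.2) Computability.encodeBool (fun q : List Bool × List Bool => lab q.1 q.2) ∧ Literature.Computability.Complexity.PolyTimeComputable (fun q : List Bool × List Bool => Literature.Computability.Complexity.boolPair q.1 q.2) Computability.encodeBool (fun q : List Bool × List Bool => elt q.1 q.2) ∧ Literature.Computability.Complexity.PolyTimeComputable (id : List Bool → List Bool) (id : List Bool → List Bool) one ∧ Literature.Computability.Complexity.PolyTimeComputable (id : List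 Bool → List Bool) (Computability.encodingList Bool).listBool.encode gens ∧ Literature.Computability.Complexity.PolyTimeComputable (fun t : List Bool × List Bool × List Bool => Literature.Computability.Complexity.boolPair t.1 (Literature.Computability.Complexity.boolPair t.2.1 t.2.2)) (id : List Bool → List Bool) (fun t : List Bool × List Bool × List Bool => mul t.1 t.2.1 t.2.2) ∧ Literature.Computability.Complexity.PolyTimeComputable (fun t : List Bool × List Bool × List Bool => Literature.Computability.Complexity.boolPair (Literature.Computability.Complexity.boolPair t.1 (Literature.Computability.Complexity.boolPair t.2.1 t.2.2)) (List.replicate (2 ^ (d * Nat.sqrt (t.1.length * Nat.log 2 t.1.length) + d)) true)) (id : List Bool → List Bool) (fun t : List Bool × List Bool × List Bool => act t.1 t.2.1 t.2.2)) ∧ ∀ c' : ℕ, ¬ ∃ A : Literature.Computability.Complexity.RandAlg (List Bool × List Bool × List Bool) (List Bool), A.RunsInTime (fun t : List Bool × List Bool × List Bool => Literature.Computability.Complexity.boolPair t.1 (Literature.Computability.Complexity.boolPair t.2.1 t.2.2)) (id : List Bool → List Bool) (fun t : List Bool × List Bool × List Bool => 2 ^ (c' * Nat.sqrt (t.1.length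 * Nat.log 2 t.1.length) + c') * ((Literature.Computability.Complexity.boolPair t.1 (Literature.Computability.Complexity.boolPair t.2.1 t.2.2)).length + 1) ^ c') ∧ ∀ p z₀ z₁, elt p z₀ = true → elt p z₁ = true → (2 : ℝ) / 3 ≤ A.pr (fun t : List Bool × List Bool × List Bool => Literature.Computability.Complexity.boolPair t.1 (Literature.Computability.Complexity.boolPair t.2.1 t.2.2)) (p, z₀, z₁) {g | lab p g = true ∧ act p g z₀ = z₁}

/-- item stmt-QuantumAdvantage-10607 · crux · rank 4 · open · by planner
why it might fail: As typed nobody has met the 6 TM2-level PolyTimeComputable clauses (m_d-padded act encoding, listBool gens) together with clause 13 (foldr/zipWith/iterate generation) and clause 11 at full size; if unsatisfiable, TorsorHard is false by typing and KuperbergPad/PadDown are vacuous.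
sources: Literature/Computability/Complexity/Randomized.lean:161 (RandAlg.RunsInTime, TM2-level), Literature/Computability/Complexity/TimeBounds.lean:125 (PolyTimeComputable), Literature/Computability/Complexity/CodeFP.lean:244 (CodeFP.polyTimeComputable), Literature/Computability/Complexity/TimeBoundsProofs.lean:674 (PolyTimeComputable.comp_holds), route-QuantumAdvantage-PadKuperberg retriage note 2026-08-15 (non-vacuity pass recommended)
[crux] NON-VACUITY (sanity crux, rank 4; decidable now) OF THE WHITE-BOX TORSOR INTERFACE AT FULL
SIZE (the retriage's recommended non-vacuity pass, filed as a served item by the route-repair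
planner 2026-08-15; expected provable via the xor family). There exist d and a family (lab, elt,
one, mul, act, gens) satisfying VERBATIM the 13 torsor-interface axioms and the 6 TM2-level
PolyTimeComputable clauses of TorsorHard / KuperbergPad (canonical labels with abelian law, free
transitive action, label length <= |prm|, generation from `gens` in the foldr/zipWith/iterate form;
lab/elt/one/gens/mul poly-time, act poly-time on the m_d-padded boolPair encoding) AND in which
every string of length |prm| is a valid label (|G_prm| = 2^|prm|). Intended witness: (Z/2)^l acting
on itself by xor -- lab p g := (|g| = |p|) =: elt p g, one p := replicate |p| false, mul p g h :=
zipWith xor g h =: act p g h, gens p := the |p| unit vectors, d := 0 (in clause 13 take es := the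
bits of g). Proof route: pointwise list lemmas for the axioms; CodeFP.polyTimeComputable /
PolyTimeComputable.comp_holds / polyTimeComputable_unpair / LengthCompare machines for the six
clauses. Value: the three load-bearing items -/
@[route_item "route-QuantumAdvantage-PadKuperberg"]
def TorsorWitness : Prop :=
  ∃ (d : ℕ) (lab elt : List Bool → List Bool → Bool) (one : List Bool → List Bool) (mul act : List Bool → List Bool → List Bool → List Bool) (gens : List Bool → List (List Bool)), ((∀ p g h, lab p g = true → lab p h = true → lab p (mul p g h) = true) ∧ (∀ p, lab p (one p) = true) ∧ (∀ p g, lab p g = true → mul p (one p) g = g) ∧ (∀ p g h k, lab p g = true → lab p h = true → lab p k = true → mul p (mul p g h) k = mul p g (mul p h k)) ∧ (∀ p g h, lab p g = true → lab p h = true → mul p g h = mul p h g) ∧ (∀ p g, lab p g = true → ∃ h, lab p h = true ∧ mul p g h = one p) ∧ (∀ p g z, lab p g = true → elt p z = true → elt p (act p g z) = true) ∧ (∀ p z, elt p z = true → act p (one p) z = z) ∧ (∀ p g h z, lab p g = true → lab p h = true → elt p z = true → act p (mul p g h) z = act p g (act p h z)) ∧ (∀ p z₀ z₁, elt p z₀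 = true → elt p z₁ = true → ∃! g, lab p g = true ∧ act p g z₀ = z₁) ∧ (∀ p g, lab p g = true → g.length ≤ p.length) ∧ (∀ p, ∀ h ∈ gens p, lab p h = true) ∧ (∀ p g, lab p g = true → ∃ es : List ℕ, g = (List.zipWith (fun h e => (mul p h)^[e] (one p)) (gens p) es).foldr (mul p) (one p))) ∧ (Literature.Computability.Complexity.PolyTimeComputable (fun q : List Bool × List Bool => Literature.Computability.Complexity.boolPair q.1 q.2) Computability.encodeBool (fun q : List Bool × List Bool => lab q.1 q.2) ∧ Literature.Computability.Complexity.PolyTimeComputable (fun q : List Bool × List Bool => Literature.Computability.Complexity.boolPair q.1 q.2) Computability.encodeBool (fun q : List Bool × List Bool => elt q.1 q.2) ∧ Literature.Computability.Complexity.PolyTimeComputable (id : List Bool → List Bool) (id : List Bool → List Bool) one ∧ Literature.Computability.Complexity.PolyTimeComputable (id : List Bool → List Bool) (Computability.encodingList Bool).listBool.encode gens ∧ Literature.Computability.Complexity.PolyTimeComputable (fun t : List Bool × List Bool × List Bool => Literature.Computability.Complexity.boolPair t.1 (Literature.Computability.Complexity.boolPair t.2.1 t.2.2)) (id : List Bool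 → List Bool) (fun t : List Bool × List Bool × List Bool => mul t.1 t.2.1 t.2.2) ∧ Literature.Computability.Complexity.PolyTimeComputable (fun t : List Bool × List Bool × List Bool => Literature.Computability.Complexity.boolPair (Literature.Computability.Complexity.boolPair t.1 (Literature.Computability.Complexity.boolPair t.2.1 t.2.2)) (List.replicate (2 ^ (d * Nat.sqrt (t.1.length * Nat.log 2 t.1.length) + d)) true)) (id : List Bool → List Bool) (fun t : List Bool × List Bool × List Bool => act t.1 t.2.1 t.2.2)) ∧ (∀ p g, g.length = p.length → lab p g = true)

/-- item stmt-QuantumAdvantage-0926 · support · rank 2 · open · by planner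
why it might fail: Not mathematically: Kuperberg 2005 Thm 7.1 (general A sketched) / CJS arXiv:1012.4019 Thm 13 (full proof, L(1/2,sqrt2) <= poly(m_c)) + Cheung-Mosca; c := max(d,1) works. Vocabulary only: ONE uniform oracle-free Clifford+T family (IsUniform, wire-0 acceptance) absorbing parsing, CM, coherent sieve.
sources: arXiv:quant-ph/0302112 Thm 7.1 p.11 (abelian hidden shift in 2^O(sqrt n) for all f.g. abelian groups; 'sketched proof'), Thm 1.1 p.3 (D_N, rigorous), arXiv:1012.4019 Thm 12-13 p.10 + Appendix p.15-19 (Childs-Jao-Soukharev: detailed proof for any finite abelian A, time L_|A|(1/2,sqrt2), poly space; group structure needed first, via Cheung-Mosca), arXiv:cs/0101004 = doi:10.26421/qic1.3-2 (Cheung-Mosca 2001, Decomposing finite abelian groups: structure of a unique-encoding black-box abelian group from generators, quantum poly time), arXiv:quant-ph/0406151 (Regev, poly-space sieve), doi:10.1137/s0097539703436345 (Kuperberg 2005, SIAM J. Comput. 35), Literature.Computability.Cryptography.BQP / BQPWith (Literature/Computability/Cryptography/ClassBQP.lean:82-101: QCircuitFamily.IsUniform, IsOracleFree, acceptProbOn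 0, two-sided error 1/3 on every string)
[crux] KUPERBERG, PADDED, OVER A WHITE-BOX TORSOR. For every white-box torsor family (canonical
labels `lab` with P-time abelian law `mul`/`one` and P-time generating list `gens`; free transitive
action `act` on the P-decidable element set `elt`, the action of an arbitrary label computable in
time polynomial in the m_d-padded input, m_d(l) = 2^(d*isqrt(l*log2 l)+d), l = |prm|; labels of
length <= |prm|) there is c >= d such that the padded vectorization-bit language L_pad(c) = {
boolPair <prm,z0,z1,unary i> 1^(m_c l) : z0,z1 valid and bit i of (boolPair g []) is 1 for the
unique g with act prm g z0 = z1 } lies in BQP (uniform oracle-free Clifford+T, error <= 1/3 on every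
string). Proof in print: vectorization of a free action is abelian HIDDEN SHIFT (f_b(g) = act g z_b,
f1(g) = f0(g+s), f0 injective by freeness); compute the group structure Z/N1 x ... x Z/Nk and
discrete-log coordinates from `gens` (Cheung-Mosca 2001: orders by Shor, relations by abelian HSP on
Z^k), run Kuperberg's sieve (quant-ph/0302112 Thm 7.1: time and queries 2^O(sqrt log|G|), |G| <=
2^(l+1)) with the adaptive measurements deferred, verify the candidate g by re-applying it
(one-sided error), read bit i; total -/
@[route_item "route-QuantumAdvantage-PadKuperberg", crux]
def KuperbergPad : Prop :=
  ∀ d : ℕ, ∃ c : ℕ, d ≤ c ∧ ∀ (lab elt : List Bool → List Bool → Bool) (one : List Bool → List Bool) (mul act : List Bool → List Bool → List Bool → List Bool) (gens : List Bool → List (List Bool)), ((∀ p g h, lab p g = true → lab p h = true → lab p (mul p g h) = true) ∧ (∀ p, lab p (one p) = true) ∧ (∀ p g, lab p g = true → mul p (one p) g = g) ∧ (∀ p g h k, lab p g = true → lab p h = true → lab p k = true → mul p (mul p g h) k = mul p g (mul p h k)) ∧ (∀ p g h, lab p g = true → lab p h = true → mul p g h = mul p h g) ∧ (∀ p g, lab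 p g = true → ∃ h, lab p h = true ∧ mul p g h = one p) ∧ (∀ p g z, lab p g = true → elt p z = true → elt p (act p g z) = true) ∧ (∀ p z, elt p z = true → act p (one p) z = z) ∧ (∀ p g h z, lab p g = true → lab p h = true → elt p z = true → act p (mul p g h) z = act p g (act p h z)) ∧ (∀ p z₀ z₁, elt p z₀ = true → elt p z₁ = true → ∃! g, lab p g = true ∧ act p g z₀ = z₁) ∧ (∀ p g, lab p g = true → g.length ≤ p.length) ∧ (∀ p, ∀ h ∈ gens p, lab p h = true) ∧ (∀ p g, lab p g = true → ∃ es : List ℕ, g = (List.zipWith (fun h e => (mul p h)^[e] (one p)) (gens p) es).foldr (mul p) (one p))) → (Literature.Computability.Complexity.PolyTimeComputable (fun q : List Bool × List Bool => Literature.Computability.Complexity.boolPair q.1 q.2) Computability.encodeBool (fun q : List Bool × List Bool => lab q.1 q.2) ∧ Literature.Computability.Complexity.PolyTimeComputable (fun q : List Bool × List Bool => Literature.Computability.Complexity.boolPair q.1 q.2) Computability.encodeBool (fun q : List Bool × List Bool => elt q.1 q.2) ∧ Literature.Computability.Complexity.PolyTimeComputable (id : List Bool → List Bool) (id : List Bool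 → List Bool) one ∧ Literature.Computability.Complexity.PolyTimeComputable (id : List Bool → List Bool) (Computability.encodingList Bool).listBool.encode gens ∧ Literature.Computability.Complexity.PolyTimeComputable (fun t : List Bool × List Bool × List Bool => Literature.Computability.Complexity.boolPair t.1 (Literature.Computability.Complexity.boolPair t.2.1 t.2.2)) (id : List Bool → List Bool) (fun t : List Bool × List Bool × List Bool => mul t.1 t.2.1 t.2.2) ∧ Literature.Computability.Complexity.PolyTimeComputable (fun t : List Bool × List Bool × List Bool => Literature.Computability.Complexity.boolPair (Literature.Computability.Complexity.boolPair t.1 (Literature.Computability.Complexity.boolPair t.2.1 t.2.2)) (List.replicate (2 ^ (d * Nat.sqrt (t.1.length * Nat.log 2 t.1.length) + d)) true)) (id : List Bool → List Bool) (fun t : List Bool × List Bool × List Bool => act t.1 t.2.1 t.2.2)) → ({w : List Bool | ∃ (p z₀ z₁ : List Bool) (i : ℕ), w = Literature.Computability.Complexity.boolPair (Literature.Computability.Complexity.boolPair p (Literature.Computability.Complexity.boolPair z₀ (Literature.Computability.Complexity.boolPair z₁ (Computability.unaryEncodeNat i)))) (List.replicate (2 ^ (c * Nat.sqrt (p.length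 * Nat.log 2 p.length) + c)) true) ∧ elt p z₀ = true ∧ elt p z₁ = true ∧ ∃ g, lab p g = true ∧ act p g z₀ = z₁ ∧ (Literature.Computability.Complexity.boolPair g []).getD i false = true} : Language Bool) ∈ Literature.Computability.Cryptography.BQP

/-- item stmt-QuantumAdvantage-0928 · support · rank 9 · open · by planner
sources: AroraBarak2009 s2.6.1, s7.4.1, Book 1974; Hartmanis-Immerman-Sewelson 1985
[support] PADDING LEMMA (classical half of the card's ratio lemma R0; provable now). If the padded
vectorization-bit language L_pad(c) of a family with unique vectorizations (free transitive action;
labels of length <= |prm|) is in BPP, then some randomized classical algorithm computes the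
vectorization label in time 2^(c'*isqrt(l*log2 l)+c') * (|input|+1)^c' with probability >= 2/3 on
every valid instance: take a Gill-form BPP machine for L_pad
(Literature.Computability.QuantumComplexity.mem_BPP_iff_gill / mem_BPP_iff_randAlg_holds), amplify
to error 1/(10(l+2)) by majority, query the 2l+2 bits of the self-delimiting string boolPair g [] on
inputs padded with 1^(m_c l) (time poly(|x| + m_c(l)) each, m_c(l) = 2^(c*isqrt(l log2 l)+c)),
union-bound, decode with boolUnpair. Sources: Book 1974 (tally languages and padding),
Hartmanis-Immerman-Sewelson 1985, Arora-Barak 2009 s2.6.1 (padding) and s7.4.1 (error reduction). -/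
@[route_item "route-QuantumAdvantage-PadKuperberg", crux]
def PadDown : Prop :=
  ∀ (c : ℕ) (lab elt : List Bool → List Bool → Bool) (act : List Bool → List Bool → List Bool → List Bool), (∀ p z₀ z₁, elt p z₀ = true → elt p z₁ = true → ∃! g, lab p g = true ∧ act p g z₀ = z₁) → (∀ p g, lab p g = true → g.length ≤ p.length) → ({w : List Bool | ∃ (p z₀ z₁ : List Bool) (i : ℕ), w = Literature.Computability.Complexity.boolPair (Literature.Computability.Complexity.boolPair p (Literature.Computability.Complexity.boolPair z₀ (Literature.Computability.Complexity.boolPair z₁ (Computability.unaryEncodeNat i)))) (List.replicate (2 ^ (c * Nat.sqrt (p.length * Nat.log 2 p.length) + c)) true) ∧ elt p z₀ = true ∧ elt p z₁ = true ∧ ∃ g, lab p g = true ∧ act p g z₀ = z₁ ∧ (Literature.Computability.Complexity.boolPair g []).getD i false = true} : Language Bool) ∈ Literature.Computability.Complexity.BPP → ∃ (c' : ℕ) (A : Literature.Computability.Complexity.RandAlg (List Bool × List Bool × List Bool) (List Bool)), A.RunsInTime (fun t : List Bool × List Bool × List Bool => Literature.Computability.Complexity.boolPair t.1 (Literature.Computability.Complexity.boolPair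 t.2.1 t.2.2)) (id : List Bool → List Bool) (fun t : List Bool × List Bool × List Bool => 2 ^ (c' * Nat.sqrt (t.1.length * Nat.log 2 t.1.length) + c') * ((Literature.Computability.Complexity.boolPair t.1 (Literature.Computability.Complexity.boolPair t.2.1 t.2.2)).length + 1) ^ c') ∧ ∀ p z₀ z₁, elt p z₀ = true → elt p z₁ = true → (2 : ℝ) / 3 ≤ A.pr (fun t : List Bool × List Bool × List Bool => Literature.Computability.Complexity.boolPair t.1 (Literature.Computability.Complexity.boolPair t.2.1 t.2.2)) (p, z₀, z₁) {g | lab p g = true ∧ act p g z₀ = z₁}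

-- item stmt-QuantumAdvantage-0930 · support · rank 9 · open · by planner — informal only, no Lean statement yet:
--   [support] CSIDH/CRS INSTANTIATION (informal until the definition csidhAction lands): GRH ∧
--   H_iso(CSIDH) → TorsorHard. Witness family: prm encodes a prime p ≡ 3 (mod 4) (padded so that |prm| ≥
--   2·log2 p); elt prm z :⇔ z encodes A ∈ F_p with the Montgomery curve E_A : y² = x³ + A x² + x
--   supersingular over F_p (⇔ #E_A(F_p) = p + 1, Schoof, P-time) on the floor End_{F_p}(E_A) ≅ Z[√−p];
--   lab prm g :⇔ g encodes the reduced primitive positive-definite binary quadratic form (a, b, c) of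
--   discriminant −4p (canonical label of an ideal class of Z[√−p]); mul = Gauss composition + reduction,
--   one = principal f

/-- item stmt-QuantumAdvantage-0931 · support · rank 9 · open · by planner
[support] GENERIC-ACTION LOWER BOUND (restricted-model evidence for TorsorHard; informal — a typed
version needs an action-oracle query model over the tree's OracleAlg). In the generic group-action
model (the group G = Z/N and the set X are accessed only through random injective labelings σ_G, σ_X
and oracles for the law, inversion and the action), every classical algorithm making q oracle
queries outputs the vectorization g of a uniformly random pair (x₀, g ⋆ x₀) with probability ≤
C·(q+1)²/N for an absolute constant C (birthday-type bound, the analogue of Shoup's Ω(√p) for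
discrete logarithms with the group law removed from the attacker's reach on X). Paired with
Kuperberg's 2^O(√log N) quantum queries (quant-ph/0302112 Thm 1.1, 'any classical algorithm requires
at least 2N^{1/2} queries on average' p.3 for the dihedral HSP form) this is the RELATIVIZED form of
the route's separation; it calibrates H_iso exactly as Shoup's bound calibrates 'ECDLP is hard'. Why
it might fail as a formal item: only the model bookkeeping (labelings as random injections; stateful
transcripts) — the bound itself is folklore/printed. Sources: Montgomery–Zhandry, Full quantum
equivalence of group action -/
@[route_item "route-QuantumAdvantage-PadKuperberg"]
def GenericActionLB : Prop :=
  ∃ C : ℕ, ∀ (n q : ℕ) (M : Literature.Computability.Complexity.OracleAlg (List Bool)), ((Finset.univ.filter fun sg : Equiv.Perm (ZMod (n + 1)) × ZMod (n + 1) => M.run (fun w => Computability.encodeNat (sg.1 (sg.1.symm ((Computability.decodeNat (Literature.Computability.Complexity.boolUnpair w).2 : ℕ) : ZMod (n + 1)) + ((Computability.decodeNat (Literature.Computability.Complexity.boolUnpair w).1 : ℕ) : ZMod (n + 1)))).val) q (Literature.Computability.Complexity.boolPair (Computability.encodeNat (sg.1 0).val) (Computability.encodeNat (sg.1 sg.2).val))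 = some (Computability.encodeNat sg.2.val)).card : ℝ) ≤ (C : ℝ) * ((q : ℝ) + 1) ^ 2 / ((n : ℝ) + 1) * (((n + 1).factorial : ℝ) * ((n : ℝ) + 1))

/-- item stmt-QuantumAdvantage-0929 · assembly · rank 1 · open · by planner
[assembly] KuperbergPad -> PadDown -> TorsorHard -> QuantumAdvantage: take the family and d from
TorsorHard, c >= d from KuperbergPad, witness L := L_pad(c) ∈ BQP; if L ∈ BPP, PadDown yields a
classical vectorization algorithm in time 2^(c' isqrt(l log l)+c') poly, contradicting TorsorHard at
c'. Pure logic over identical interface clauses (checked rc 0 with an explicit proof term in the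
planner's sketch). -/
@[route_item "route-QuantumAdvantage-PadKuperberg"]
def Assembly : Prop :=
  KuperbergPad → PadDown → TorsorHard → QuantumAdvantage

/-! D-0027 §2.1 — DECIDING THEOREM (planner-authored via `route open/edit --closes-file`; by planner-rbadge-QuantumAdvantage-PadKuperberg-a70c75f4-g2-0 2026-08-15T16:10:55Z):
its hypotheses are this route's items and its conclusion the sub-problem Statement (glue_lint), and it elaborates with this file. -/

@[closes "route-QuantumAdvantage-PadKuperberg"] theorem closes (h₁ : KuperbergPad) (h₂ : PadDown) (h₃ : TorsorHard) : QuantumAdvantage := by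
  obtain ⟨d, lab, elt, one, mul, act, gens, hAX, hPT, hHard⟩ := h₃
  obtain ⟨c, -, hc⟩ := h₁ d
  refine ⟨_, hc lab elt one mul act gens hAX hPT, fun hBPP => ?_⟩
  obtain ⟨c', A, hr, hs⟩ :=
    h₂ c lab elt act hAX.2.2.2.2.2.2.2.2.2.1 hAX.2.2.2.2.2.2.2.2.2.2.1 hBPP
  exact hHard c' ⟨A, hr, hs⟩

end Summit.QuantumAdvantage.QuantumAdvantage.Theses.PadKuperberg
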